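import Mathlib
import Summits.NavierStokesRegularity.NavierStokesRegularity.Theses.RootDecompEpochRecut
import HarnessLib

/-!
# RootDecompEpochRecut — glue `NoIllPosedEpoch_of_cells` (stmt-NavierStokesRegularity-32196) PROVED

Route N21 `route-NavierStokesRegularity-RootDecompEpochRecut`, the GLUE of the ARRIVAL RECUT (lens-3 g9; writer g4):
`TypeIEpochsWellPosed → TypeIIEpochsWellPosed → ClusterEpochsWellPosed → NoIllPosedEpoch` — recomposition by
excluded middle on the arrival type of the epoch `τ` (Type I slicewise on a left slab / isolated but not Type I /
not isolated = cluster). The three cells carry, verbatim, the hypotheses `TypeI`, `Isolated ∧ ¬TypeI`, `¬Isolated`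
in front of the same conclusion, so the glue is propositional. The writer's evidence file `GlueProofN21B.lean`
(g4, `ArrivalGlueLite.glue_holds`) proves the same; it is not mounted in this seat's jail, so the glue is re-proved
here on the tree decls. Pure logic; Navier–Stokes regularity is NOT proved by anything here (rung 0).
-/

-- the summit and its single sub-problem share the name (CONVENTIONS §1), as in every Theorems file
set_option linter.dupNamespace false

namespace Summit.NavierStokesRegularity.NavierStokesRegularity.Theorems.EpochRecut

open Summit.NavierStokesRegularity.NavierStokesRegularity.Theses.RootDecompEpochRecut

/-- **Glue of the arrival recut** (stmt-NavierStokesRegularity-32196): the three arrival cells imply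
`NoIllPosedEpoch`, by excluded middle on whether the epoch is Type I on a left slab, and if not, whether it is
isolated. [folklore] -/
theorem noIllPosedEpoch_of_cells_proof : NoIllPosedEpoch_of_cells := by
  unfold NoIllPosedEpoch_of_cells NoIllPosedEpoch TypeIEpochsWellPosed TypeIIEpochsWellPosed
    ClusterEpochsWellPosed
  intro hI hII hc ν hν u₀ hsm hdiv hdec u hu τ hτ
  by_cases hTI : ∃ δ M : ℝ, 0 < δ ∧ 0 ≤ M ∧ ∀ t ∈ Set.Ioo (τ - δ) τ,
      ∀ᵐ x ∂MeasureTheory.volume, ‖u t x‖ ≤ M / Real.sqrt (τ - t)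
  · exact hI ν hν u₀ hsm hdiv hdec u hu τ hτ hTI
  by_cases hiso : ∃ δ : ℝ, 0 < δ ∧ ∀ ε : ℝ, 0 < ε → ∃ M : ℝ, ∀ t ∈ Set.Ioo (τ - δ) (τ - ε),
      ∀ᵐ x ∂MeasureTheory.volume, ‖u t x‖ ≤ M
  · exact hII ν hν u₀ hsm hdiv hdec u hu τ hτ hiso hTI
  · exact hc ν hν u₀ hsm hdiv hdec u hu τ hτ hiso

/-- **Exactness of the arrival recut**: `NoIllPosedEpoch ↔ TypeIEpochsWellPosed ∧ TypeIIEpochsWellPosed ∧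
ClusterEpochsWellPosed` (each cell is the parent restricted to its arrival type). [folklore] -/
theorem noIllPosedEpoch_iff_cells :
    NoIllPosedEpoch ↔ TypeIEpochsWellPosed ∧ TypeIIEpochsWellPosed ∧ ClusterEpochsWellPosed := by
  constructor
  · intro h
    refine ⟨?_, ?_, ?_⟩
    · intro ν hν u₀ hsm hdiv hdec u hu τ hτ _
      exact h ν hν u₀ hsm hdiv hdec u hu τ hτ
    · intro ν hν u₀ hsm hdiv hdec u hu τ hτ _ _
      exact h ν hν u₀ hsm hdiv hdec u hu τ hτ
    · intro ν hν u₀ hsm hdiv hdec u hu τ hτ _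
      exact h ν hν u₀ hsm hdiv hdec u hu τ hτ
  · rintro ⟨hI, hII, hc⟩
    exact noIllPosedEpoch_of_cells_proof hI hII hc

end Summit.NavierStokesRegularity.NavierStokesRegularity.Theorems.EpochRecut
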